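import Summits.Ventures.Crystal3D.Bulk.LocalTwelve
import HarnessLib

/-!
# From the first-shell COUNT to POSITIONAL order: Barlow radius-2 patches, modulo the radius-2 lemma

HONEST FRAMING. Part of the venture `Summits/Ventures/Crystal3D` (cell `pub-crystal3d`, phase 2).
`BulkCrystallization3D K` (file `Bulk/LocalTwelve.lean`) is a COUNT: all but `K · N^{2/3}` balls
of a sticky ground state have a close-packed (cuboctahedral / anticuboctahedral) FIRST shell. It
says nothing positional. This file TYPES the finite local lemma that upgrades the count to
positional (layered, fcc/hcp/stacking-fault) order and PROVES the upgrade by counting: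

* `WithinTwo x i j` — ball `j` is within contact-graph distance `2` of ball `i`;
* `IsBarlowPatchCentre x i` — some isometry of `ℝ³` carries every ball within contact distance `2`
  of `i` into ONE Barlow stacking with touching spacings (tree set `barlowStacking 1 √(2/3) σ`,
  `IsHaggSeq σ`; same shape as the venture's `IsBarlowFragment`);
* `RadiusTwoBarlow` — **the radius-2 lemma (L2B)**, OUR named statement (not a Literature fact):
  in every finite unit packing, if `i` and every ball within contact distance `2` of `i` have
  close-packed first shells, then `i` is a Barlow patch centre. STATUS: **PROVED in the tree** —
  `radiusTwoBarlow_holds` (`Bulk/RadiusTwoBarlowHolds.lean`, p384946; standard axioms, 0 compiled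
  evaluations): a census-free structural kernel proof (adapted frames, the hcp mirror hexagon,
  hexagon transfer, the cuboctahedron witness lemma; bricks `Bulk/L2bFrames`, `L2bHexagonSteps`,
  `L2bTables`, `L2bTransfer`, `L2bBarlow`), which SUPERSEDES — and is consistent with, but does
  not use — the cell's earlier exhaustive exact computation outside the kernel (HOME
  `step0/max13/cpshell/CPEXT-RESULT.md` §7–§8: around a cuboctahedral ball the 35 joint choices of
  close-packed neighbour shells = 13 Barlow systems + 22 multi-twin systems each forcing a
  second-shell ball with no close-packed shell; 4/4 Barlow around an anticuboctahedral ball).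
  Radius ONE does NOT suffice (the 22 multi-twin systems are radius-1 counterexamples, ibid. §7;
  the kernel statement needs and uses radius 2). This file states L2B as a `Prop` so that the
  counting upgrade `positionalOrder_of_bulk` is modular; `positionalOrder_of_bulk'`
  (`Bulk/RadiusTwoBarlowHolds.lean`) discharges it, and its hypothesis-free instance at `K = 130`
  is `positionalOrder130` (`Bulk/PositionalOrder130.lean`, p418070: COMPUTATIONAL grade — the
  axiom closure of the head `bulkCrystallization3D_130` exactly; a LOCAL radius-2 layered-order
  statement for all but `157 · 130 · N^{2/3}` balls, not a global single-stacking claim).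
* PROVED: `card_filter_withinTwo_le` (a radius-2 covering count with the kissing number:
  `#{i : ∃ j ∈ D, WithinTwo x i j} ≤ 157 · #D`), `card_nonBarlowCentre_le`
  (`RadiusTwoBarlow → #{i : ¬ IsBarlowPatchCentre x i} ≤ 157 · #(nonClosePacked x)`), and
  **`positionalOrder_of_bulk : BulkCrystallization3D K → RadiusTwoBarlow → in every sticky ground
  state all but `157 · K · N^{2/3}` balls are centres of Barlow radius-2 patches`**.

So the coordinator's «second shell» is needed in the finite lemma `RadiusTwoBarlow`, not in the
per-ball score whose sum certifies `BulkCrystallization3D`. The constant `157 = 1 + 12 + 144`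
bounds a contact-graph ball of radius `2` via the kissing number (`coordination_le_twelve`);
`145` would follow by excluding back-edges and is not pursued.
-/

noncomputable section

open Finset

namespace Summit.Ventures.Crystal3D

open Literature.MathematicalPhysics.StatisticalMechanics (barlowStacking IsHaggSeq)

variable {N : ℕ}

/-! ## Radius-2 contact neighbourhoods and Barlow patches -/

/-- Ball `j` lies within contact-graph distance `2` of ball `i`: `j = i`, or `j` touches `i`, or
`j` touches a ball touching `i`. -/
def WithinTwo (x : Fin N → EuclideanSpace ℝ (Fin 3)) (i j : Fin N) : Prop :=
  j = i ∨ j ∈ contactNeighbors x i ∨ ∃ k ∈ contactNeighbors x i, j ∈ contactNeighbors x k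

/-- Ball `i` is the **centre of a Barlow radius-2 patch**: some isometry of `ℝ³` carries every
ball within contact distance `2` of `i` into one Barlow stacking with touching spacings
(`a = 1`, `h = √(2/3)`) and some Hägg word `σ` — i.e. the radius-2 contact neighbourhood of `i`
is a fragment of an fcc / hcp / stacking-faulted close packing. -/
def IsBarlowPatchCentre (x : Fin N → EuclideanSpace ℝ (Fin 3)) (i : Fin N) : Prop :=
  ∃ σ : ℤ → ℤ, IsHaggSeq σ ∧
    ∃ g : EuclideanSpace ℝ (Fin 3) ≃ᵢ EuclideanSpace ℝ (Fin 3),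
      ∀ j, WithinTwo x i j → g (x j) ∈ barlowStacking 1 (Real.sqrt (2 / 3)) σ

/-- **The radius-2 lemma (L2B)** — OUR named statement, PROVED in the tree as
`radiusTwoBarlow_holds` (`Bulk/RadiusTwoBarlowHolds.lean`, standard axioms; this file predates
that proof and keeps the statement as a `Prop` so that the counting upgrade below is stated
modulo it): in every finite packing of unit-diameter balls in `ℝ³`, a ball all of whose
contact-distance-`≤ 2` neighbourhood (itself included) consists of balls with close-packed first
shells is the centre of a Barlow radius-2 patch. -/
def RadiusTwoBarlow : Prop :=
  ∀ (N : ℕ) (x : Fin N → EuclideanSpace ℝ (Fin 3)), IsUnitPacking x → ∀ i : Fin N,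
    (∀ j, WithinTwo x i j → IsClosePackedShell x j) → IsBarlowPatchCentre x i

open scoped Classical in
/-- The balls that are NOT centres of Barlow radius-2 patches. -/
def nonBarlowCentre (x : Fin N → EuclideanSpace ℝ (Fin 3)) : Finset (Fin N) :=
  univ.filter fun i => ¬ IsBarlowPatchCentre x i

/-- Membership in `nonBarlowCentre`. -/
theorem mem_nonBarlowCentre {x : Fin N → EuclideanSpace ℝ (Fin 3)} {i : Fin N} :
    i ∈ nonBarlowCentre x ↔ ¬ IsBarlowPatchCentre x i := by
  simp [nonBarlowCentre]

/-! ## The radius-2 covering count -/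

variable {x : Fin N → EuclideanSpace ℝ (Fin 3)}

/-- `WithinTwo` is symmetric (contact is). -/
theorem WithinTwo.symm {i j : Fin N} (h : WithinTwo x i j) : WithinTwo x j i := by
  rcases h with rfl | h | ⟨k, hk, hj⟩
  · exact Or.inl rfl
  · exact Or.inr (Or.inl ((mem_contactNeighbors_comm x).1 h))
  · exact Or.inr (Or.inr ⟨k, (mem_contactNeighbors_comm x).1 hj, (mem_contactNeighbors_comm x).1 hk⟩)

open scoped Classical in
/-- The contact-graph ball of radius `2` around the balls of `D` is covered by `D`, the contact
neighbours of `D`, and their contact neighbours. -/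
theorem subset_radiusTwo_cover (D : Finset (Fin N)) :
    (univ.filter fun i => ∃ j ∈ D, WithinTwo x i j) ⊆
      D ∪ (D.biUnion fun j => contactNeighbors x j) ∪
        ((D.biUnion fun j => contactNeighbors x j).biUnion fun k => contactNeighbors x k) := by
  intro i hi
  obtain ⟨j, hjD, hw⟩ := (mem_filter.1 hi).2
  rcases hw.symm with h | h | ⟨k, hk, hik⟩
  · -- i = j
    exact mem_union_left _ (mem_union_left _ (h ▸ hjD))
  · exact mem_union_left _ (mem_union_right _ (mem_biUnion.2 ⟨j, hjD, h⟩))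
  · exact mem_union_right _ (mem_biUnion.2 ⟨k, mem_biUnion.2 ⟨j, hjD, hk⟩, hik⟩)

open scoped Classical in
/-- **Radius-2 covering count** (kissing number twelve): the number of balls within contact
distance `2` of a set `D` is at most `157 · #D` (`157 = 1 + 12 + 12·12`). -/
theorem card_filter_withinTwo_le (hx : IsUnitPacking x) (D : Finset (Fin N)) :
    (univ.filter fun i => ∃ j ∈ D, WithinTwo x i j).card ≤ 157 * D.card := by
  have h12 : ∀ j, (contactNeighbors x j).card ≤ 12 := fun j => coordination_le_twelve hx j
  have hB : (D.biUnion fun j => contactNeighbors x j).card ≤ 12 * D.card :=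
    calc (D.biUnion fun j => contactNeighbors x j).card ≤ ∑ j ∈ D, (contactNeighbors x j).card :=
          card_biUnion_le
      _ ≤ ∑ _j ∈ D, 12 := sum_le_sum fun j _ => h12 j
      _ = 12 * D.card := by simp [mul_comm]
  have hC : ((D.biUnion fun j => contactNeighbors x j).biUnion fun k => contactNeighbors x k).card
      ≤ 144 * D.card :=
    calc ((D.biUnion fun j => contactNeighbors x j).biUnion fun k => contactNeighbors x k).card
          ≤ ∑ k ∈ D.biUnion (fun j => contactNeighbors x j), (contactNeighbors x k).card :=
          card_biUnion_le
      _ ≤ ∑ _k ∈ D.biUnion (fun j => contactNeighbors x j), 12 := sum_le_sum fun k _ => h12 k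
      _ = 12 * (D.biUnion fun j => contactNeighbors x j).card := by simp [mul_comm]
      _ ≤ 12 * (12 * D.card) := Nat.mul_le_mul_left _ hB
      _ = 144 * D.card := by ring
  calc (univ.filter fun i => ∃ j ∈ D, WithinTwo x i j).card
      ≤ (D ∪ (D.biUnion fun j => contactNeighbors x j) ∪
          ((D.biUnion fun j => contactNeighbors x j).biUnion fun k => contactNeighbors x k)).card :=
        card_le_card (subset_radiusTwo_cover D)
    _ ≤ (D ∪ (D.biUnion fun j => contactNeighbors x j)).card +
          ((D.biUnion fun j => contactNeighbors x j).biUnion fun k => contactNeighbors x k).card :=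
        card_union_le _ _
    _ ≤ (D.card + (D.biUnion fun j => contactNeighbors x j).card) +
          ((D.biUnion fun j => contactNeighbors x j).biUnion fun k => contactNeighbors x k).card := by
        gcongr; exact card_union_le _ _
    _ ≤ (D.card + 12 * D.card) + 144 * D.card := by gcongr
    _ = 157 * D.card := by ring

/-! ## The positional upgrade -/

open scoped Classical in
/-- Under the radius-2 lemma, every ball that is not a Barlow patch centre lies within contact
distance `2` of a ball whose first shell is not close-packed. -/
theorem nonBarlowCentre_subset (hx : IsUnitPacking x) (h2 : RadiusTwoBarlow) :
    nonBarlowCentre x ⊆ univ.filter fun i => ∃ j ∈ nonClosePacked x, WithinTwo x i j := by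
  intro i hi
  rw [mem_nonBarlowCentre] at hi
  refine mem_filter.2 ⟨mem_univ _, ?_⟩
  by_contra hno
  push Not at hno
  exact hi (h2 N x hx i fun j hj => by
    by_contra hcp
    exact hno j (mem_nonClosePacked.2 hcp) hj)

/-- **Counting form of the upgrade**: under the radius-2 lemma, in every packing
`#{i : ¬ IsBarlowPatchCentre x i} ≤ 157 · #(nonClosePacked x)`. -/
theorem card_nonBarlowCentre_le (hx : IsUnitPacking x) (h2 : RadiusTwoBarlow) :
    (nonBarlowCentre x).card ≤ 157 * (nonClosePacked x).card :=
  (card_le_card (nonBarlowCentre_subset hx h2)).trans (card_filter_withinTwo_le hx _)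

/-- **Positional order from the first-shell count.** If all but `K · N^{2/3}` balls of every
sticky ground state have close-packed first shells (`BulkCrystallization3D K`) and the radius-2
lemma holds, then all but `157 · K · N^{2/3}` balls of every sticky ground state are centres of
Barlow radius-2 patches: local fcc / hcp / stacking-fault order in the positional sense, with
stacking as the only freedom. -/
theorem positionalOrder_of_bulk {K : ℝ} (hK : BulkCrystallization3D K) (h2 : RadiusTwoBarlow)
    (x : Fin N → EuclideanSpace ℝ (Fin 3)) (hx : IsStickyGroundState x) :
    ((nonBarlowCentre x).card : ℝ) ≤ 157 * K * (N : ℝ) ^ ((2 : ℝ) / 3) := by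
  have h1 : ((nonBarlowCentre x).card : ℝ) ≤ 157 * ((nonClosePacked x).card : ℝ) := by
    exact_mod_cast card_nonBarlowCentre_le hx.1 h2
  have h2' : ((nonClosePacked x).card : ℝ) ≤ K * (N : ℝ) ^ ((2 : ℝ) / 3) := hK N x hx
  calc ((nonBarlowCentre x).card : ℝ) ≤ 157 * ((nonClosePacked x).card : ℝ) := h1
    _ ≤ 157 * (K * (N : ℝ) ^ ((2 : ℝ) / 3)) := by gcongr
    _ = 157 * K * (N : ℝ) ^ ((2 : ℝ) / 3) := by ring

end Summit.Ventures.Crystal3D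

end
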